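import Mathlib
import Summits.Ventures.LatticeQCDFlow.Scoring.CalibrationTruths
import Summits.Ventures.LatticeQCDFlow.Scoring.BartlettKernel
import Summits.Ventures.LatticeQCDFlow.Scoring.MadrasSokalWindowConstant
import HarnessLib

/-!
# A first moment of `ρ` gives a first moment of `K = acfConv ρ̄`: `Σ_u (u+1)|K(u+1)| ≤ 2 ‖ρ̄‖₁ · Σ_m |m||ρ̄(m)|`, so the window-constant theorem applies to every ACF with `Σ t|ρ(t)| < ∞`

HONEST FRAMING: exact (Metropolis-corrected) sampling algorithms for lattice gauge theory;
figures of merit are autocorrelation/cost numbers at stated couplings and volumes; no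
continuum-physics claim.

Venture `LatticeQCDFlow` (cell pub-lqcd), sub-topic `Scoring`; FANOUT row 16 (`su2-base`), GEN-6.
NEW WORK of the cell over this packet (`BartlettKernel`: `acfConv`, `shearEquiv`;
`MadrasSokalWindowConstant`: `tendsto_tauHatAVar_sub_lin` under `Σ_t (t+1)|K(t+1)| < ∞`).  Nothing
is cited as a fact.  Ninth file of the ERROR-OF-THE-ERROR packet: it discharges the kernel-level
hypothesis of the seventh from the natural hypothesis on the autocorrelation function itself — the
same first moment `Σ_t t|ρ(t)| < ∞` under which the tree bounds the definition bias of `τ_int`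
(`VarianceOfTheMean.abs_tauInt_sub_tauIntN_le`).

* `summable_weighted_prod` — `(u, m) ↦ (|m+u| + |m|)·|c(m)|·|c(m+u)|` is summable on `ℤ × ℤ` when
  `c` and `m ↦ |m| c(m)` are (it is the shear of `|c| ⊗ (|·||c|) + (|·||c|) ⊗ |c|`);
* **`summable_moment_acfConv`** — then `Σ_{t≥0} (t+1)|K(t+1)| < ∞` (`t + 1 ≤ |m+t+1| + |m|`
  termwise);
* `summable_abs_mul_evenExt` — for `ρ : ℕ → ℝ` with `Σ t|ρ t| < ∞` (and `Σ|ρ| < ∞`), `m ↦ |m| ρ̄(m)`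
  is summable over `ℤ`; **`summable_moment_acfConv_evenExt`** — the hypothesis of
  `tendsto_tauHatAVar_sub_lin` holds; **`tendsto_tauHatAVar_sub_lin_of_moment`**,
  **`tendsto_tauHatRatioAVar_sub_lin_of_moment`** — the window-constant limits
  `V(W) − 4τ²W → windowConst ρ`, `R(W) − 4τ²W → windowConst ρ + ratioLimit ρ` for every summable
  normalised `ρ` with a first moment.

NOT CLAIMED: the constant `2‖ρ̄‖₁ Σ|m||ρ̄(m)|` as a bound on `|windowConst|` (only summability is
extracted); anything non-Gaussian.
-/

noncomputable section

open Finset Filter Topology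

namespace Summit.Ventures.LatticeQCDFlow.Scoring

/-! ## The weighted shear -/

/-- The family `(u, m) ↦ (|m+u| + |m|)·|c(m)|·|c(m+u)|` is summable on `ℤ × ℤ` as soon as `c` and
`m ↦ |m|·c(m)` are summable: it is the shear of `|c(m)|·(|n||c(n)|) + (|m||c(m)|)·|c(n)|`. -/
theorem summable_weighted_prod {c : ℤ → ℝ} (hc : Summable c)
    (hm : Summable fun m : ℤ => |(m : ℝ)| * c m) :
    Summable fun p : ℤ × ℤ => (|((p.2 + p.1 : ℤ) : ℝ)| + |((p.2 : ℤ) : ℝ)|) * |c p.2| * |c (p.2 + p.1)| := by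
  have hm' : Summable fun m : ℤ => ‖|(m : ℝ)| * c m‖ := hm.norm
  have h1 := summable_mul_of_summable_norm hc.norm.norm hm'.norm
  have h2 := summable_mul_of_summable_norm hm'.norm hc.norm.norm
  -- `G(m, n) = |c m|·(|n||c n|) + (|m||c m|)·|c n|` on `ℤ × ℤ`
  have hG : Summable fun q : ℤ × ℤ =>
      ‖c q.1‖ * ‖|(q.2 : ℝ)| * c q.2‖ + ‖|(q.1 : ℝ)| * c q.1‖ * ‖c q.2‖ := h1.add h2
  have := (shearEquiv.summable_iff (f := fun q : ℤ × ℤ =>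
      ‖c q.1‖ * ‖|(q.2 : ℝ)| * c q.2‖ + ‖|(q.1 : ℝ)| * c q.1‖ * ‖c q.2‖)).mpr hG
  refine this.congr fun p => ?_
  simp only [Function.comp_apply, shearEquiv, Equiv.coe_fn_mk, Real.norm_eq_abs, abs_mul, abs_abs]
  push_cast
  ring

/-- **A first moment of `c` gives a first moment of `K`**: `Σ_{t≥0} (t+1)|K(t+1)| < ∞`. -/
theorem summable_moment_acfConv {c : ℤ → ℝ} (hc : Summable c)
    (hm : Summable fun m : ℤ => |(m : ℝ)| * c m) :
    Summable fun t : ℕ => ((t : ℝ) + 1) * |acfConv c ((t : ℤ) + 1)| := by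
  have hP := summable_weighted_prod hc hm
  -- the fibre sums `F(u) = Σ_m (|m+u| + |m|)|c m||c(m+u)|` are summable in `u`
  have hF : Summable fun u : ℤ => ∑' m : ℤ,
      (|((m + u : ℤ) : ℝ)| + |((m : ℤ) : ℝ)|) * |c m| * |c (m + u)| := hP.prod
  have hFn : Summable fun t : ℕ => ∑' m : ℤ,
      (|((m + ((t : ℤ) + 1) : ℤ) : ℝ)| + |((m : ℤ) : ℝ)|) * |c m| * |c (m + ((t : ℤ) + 1))| :=
    hF.comp_injective (i := fun t : ℕ => (t : ℤ) + 1) fun a b h => by simpa using h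
  refine Summable.of_nonneg_of_le (fun t => by positivity) (fun t => ?_) hFn
  -- termwise: `(t+1)|K(t+1)| ≤ Σ_m (t+1)|c m||c(m+t+1)| ≤ Σ_m (|m+t+1| + |m|)|c m||c(m+t+1)|`
  have hs := summable_mul_shift hc ((t : ℤ) + 1)
  have hfib : Summable fun m : ℤ =>
      (|((m + ((t : ℤ) + 1) : ℤ) : ℝ)| + |((m : ℤ) : ℝ)|) * |c m| * |c (m + ((t : ℤ) + 1))| :=
    hP.prod_factor ((t : ℤ) + 1)
  rw [acfConv_def]
  calc ((t : ℝ) + 1) * |∑' m, c m * c (m + ((t : ℤ) + 1))|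
      ≤ ((t : ℝ) + 1) * ∑' m, |c m * c (m + ((t : ℤ) + 1))| := by
        refine mul_le_mul_of_nonneg_left ?_ (by positivity)
        have := norm_tsum_le_tsum_norm hs.norm
        simpa only [Real.norm_eq_abs] using this
    _ = ∑' m, ((t : ℝ) + 1) * (|c m| * |c (m + ((t : ℤ) + 1))|) := by
        rw [← tsum_mul_left]
        refine tsum_congr fun m => ?_
        rw [abs_mul]
    _ ≤ ∑' m, (|((m + ((t : ℤ) + 1) : ℤ) : ℝ)| + |((m : ℤ) : ℝ)|) * |c m| * |c (m + ((t : ℤ) + 1))| := by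
        refine Summable.tsum_le_tsum (fun m => ?_) (hs.abs.mul_left _ |>.congr fun m => by
          rw [abs_mul]) hfib
        rw [mul_assoc]
        refine mul_le_mul_of_nonneg_right ?_ (by positivity)
        -- `t + 1 = |(m + t + 1) − m| ≤ |m + t + 1| + |m|`
        have : ((t : ℝ) + 1) = |((m + ((t : ℤ) + 1) : ℤ) : ℝ) - ((m : ℤ) : ℝ)| := by
          push_cast
          rw [show (m : ℝ) + ((t : ℝ) + 1) - m = (t : ℝ) + 1 by ring, abs_of_nonneg (by positivity)]
        rw [this]
        exact abs_sub _ _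

/-! ## From `ρ : ℕ → ℝ` -/

/-- A first moment of `ρ` on `ℕ` gives one of `ρ̄` on `ℤ`: `m ↦ |m| ρ̄(m)` is summable. -/
theorem summable_abs_mul_evenExt {ρ : ℕ → ℝ} (hm : Summable fun t : ℕ => (t : ℝ) * ρ t) :
    Summable fun m : ℤ => |(m : ℝ)| * evenExt ρ m := by
  refine Summable.of_nat_of_neg ?_ ?_
  · refine hm.congr fun t => ?_
    simp [Nat.abs_cast]
  · refine hm.congr fun t => ?_
    simp [Nat.abs_cast, abs_neg]

/-- **The kernel first-moment hypothesis of `MadrasSokalWindowConstant` holds** for every summable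
`ρ` with `Σ_t t|ρ t| < ∞`. -/
theorem summable_moment_acfConv_evenExt {ρ : ℕ → ℝ} (hρ : Summable ρ)
    (hm : Summable fun t : ℕ => (t : ℝ) * |ρ t|) :
    Summable fun t : ℕ => ((t : ℝ) + 1) * |acfConv (evenExt ρ) ((t : ℤ) + 1)| := by
  have h1 : Summable fun m : ℤ => |(m : ℝ)| * evenExt (fun t => |ρ t|) m :=
    summable_abs_mul_evenExt hm
  have h2 : Summable fun m : ℤ => |(m : ℝ)| * evenExt ρ m := by
    refine Summable.of_norm (h1.congr fun m => ?_)
    simp [evenExt, abs_abs]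
  exact summable_moment_acfConv (summable_evenExt hρ) h2

/-- **`V(W) − 4 τ_int² W → windowConst ρ`** for every summable normalised `ρ` with a first moment
`Σ_t t|ρ(t)| < ∞`. -/
theorem tendsto_tauHatAVar_sub_lin_of_moment {ρ : ℕ → ℝ} (hρ : Summable ρ) (h0 : ρ 0 = 1)
    (hm : Summable fun t : ℕ => (t : ℝ) * |ρ t|) :
    Tendsto (fun W : ℕ => tauHatAVar ρ W - 4 * tauInt ρ ^ 2 * W) atTop (𝓝 (windowConst ρ)) :=
  tendsto_tauHatAVar_sub_lin hρ h0 (summable_moment_acfConv_evenExt hρ hm)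

/-- **`R(W) − 4 τ_int² W → windowConst ρ + ratioLimit ρ`** under the same hypotheses. -/
theorem tendsto_tauHatRatioAVar_sub_lin_of_moment {ρ : ℕ → ℝ} (hρ : Summable ρ) (h0 : ρ 0 = 1)
    (hm : Summable fun t : ℕ => (t : ℝ) * |ρ t|) :
    Tendsto (fun W : ℕ => tauHatRatioAVar ρ W - 4 * tauInt ρ ^ 2 * W) atTop
      (𝓝 (windowConst ρ + ratioLimit ρ)) :=
  tendsto_tauHatRatioAVar_sub_lin hρ h0 (summable_moment_acfConv_evenExt hρ hm)

/-- For `0 ≤ ρ ≤ 1` with a first moment: eventually `V(W) < (4W+2)τ² − (6τ² − 2τ) + ε`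
(`MadrasSokalWindowConstant.eventually_tauHatAVar_lt_printed_sub`, hypothesis discharged). -/
theorem eventually_tauHatAVar_lt_printed_sub_of_moment {ρ : ℕ → ℝ} (hρ : Summable ρ)
    (h0 : ρ 0 = 1) (hnn : ∀ t, 0 ≤ ρ t) (hle : ∀ t, ρ t ≤ 1)
    (hm : Summable fun t : ℕ => (t : ℝ) * |ρ t|) {ε : ℝ} (hε : 0 < ε) :
    ∀ᶠ W : ℕ in atTop, tauHatAVar ρ W
      < (4 * W + 2) * tauInt ρ ^ 2 - (6 * tauInt ρ ^ 2 - 2 * tauInt ρ) + ε :=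
  eventually_tauHatAVar_lt_printed_sub hρ h0 hnn hle (summable_moment_acfConv_evenExt hρ hm) hε

end Summit.Ventures.LatticeQCDFlow.Scoring
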